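import Mathlib.GroupTheory.Perm.Cycle.Factors
import Literature.Combinatorics.SimpleGraph.PfaffianBipartite
import HarnessLib

/-!
# Pfaffian bipartite graphs and directed circuits (Little 1975 §2; Robertson–Seymour–Thomas 7.4)

Topic `Combinatorics/SimpleGraph`; theorems only. Tools for the hard direction of Little's theorem
(`Little1975_isPfaffianBipartite_iff_not_isMatchingMinor`, `LittleTheorem.lean`).

Fix a perfect matching `M` of the bipartite graph `G` (edge-set encoding `G ⊆ Fin n × Fin n`,
`MatchingMinor.lean`); after relabelling the columns, `M` is the DIAGONAL `{(i, i)}`. The digraph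
`D(G, M)` of Robertson–Seymour–Thomas §7 ("direct every edge from `A` to `B` and contract every
edge of `M`") has vertex set `Fin n` and an arc `i → j` for every off-diagonal edge `(i, j) ∈ G`;
its directed circuits are exactly the CYCLIC permutations `γ` (`Equiv.Perm.IsCycle`) all of whose
cells `(i, γ i)` lie in `G` (fixed points use the diagonal), and perfect matchings of `G` are the
permutations inside `G`, i.e. vertex-disjoint unions of directed circuits (Little 1975, Lemma 1:
"the alternating circuits consanguineous with respect to `f` are the directed circuits of `G_f`").

* `IsPfaffianBipartite.exists_isPolyaSigning_diag` — a Pfaffian `G ⊇ diagonal` has a Pólya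
  signing equal to `+1` on the diagonal (rescale the rows);
* `isPfaffianBipartite_iff_forall_isCycle` — **`G ⊇ diagonal` is Pfaffian iff some signing, `+1`
  on the diagonal, makes every directed circuit positive**: `sign γ * ∏ i, s (i, γ i) = 1` for
  every cyclic `γ` inside `G` (Little 1975 §2, (11): "`G` is Pfaffian iff there is a set `S` of
  edges meeting every directed circuit of `G_f` in an odd number of edges"; Robertson–Seymour–Thomas
  1999, 7.4: "`G` has a Pfaffian orientation iff `D(G, M)` is not even"). Proof of "⇐": a
  permutation inside `G` is a disjoint product of cyclic permutations inside `G`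
  (`Equiv.Perm.cycle_induction_on`), and signs and weights are multiplicative;
* `isPfaffianBipartite_iff_forall_isCycle'` — the same with the sign of a cycle made explicit:
  `∏ i, s (i, γ i) = -(-1) ^ #γ.support` (a circuit on `ℓ` matched pairs must carry an odd
  number of `-1`'s iff `ℓ` is even: Little's odd-set condition, Seymour–Thomassen's odd weightings).

## References

* C. H. C. Little, *A characterization of convertible (0,1)-matrices*, J. Combin. Theory Ser. B
  18 (1975) 187–208, §2 (Lemma 1 and (11)). [Little1975]
* N. Robertson, P. D. Seymour, R. Thomas, *Permanents, Pfaffian orientations, and even directed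
  circuits*, Ann. of Math. 150 (1999) 929–975, §7, (7.4). [RobertsonSeymourThomas1999]
-/

namespace Literature.Combinatorics.SimpleGraph

open Equiv Finset

variable {n : ℕ}

/-- **Normalising a Pólya signing on the reference matching**: if the diagonal is a perfect
matching of the Pfaffian graph `G`, some Pólya signing of `G` is `+1` on the diagonal (multiply
row `i` by `s (i, i)`; the identity matching being positive, `∏ i, s (i, i) = 1`). [folklore] -/
theorem IsPfaffianBipartite.exists_isPolyaSigning_diag {G : Finset (Fin n × Fin n)}
    (hG : IsPfaffianBipartite G) (hdiag : ∀ i, (i, i) ∈ G) :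
    ∃ s : Fin n × Fin n → ℤˣ, IsPolyaSigning G s ∧ ∀ i, s (i, i) = 1 := by
  obtain ⟨s, hs⟩ := hG
  refine ⟨fun e => s (e.1, e.1) * s e, fun σ hσ => ?_, fun i => Int.units_mul_self _⟩
  have h1 := hs 1 (fun i => by simpa using hdiag i)
  simp only [Perm.sign_one, one_mul, Perm.coe_one, id_eq] at h1
  show Perm.sign σ * ∏ i, s (i, i) * s (i, σ i) = 1
  rw [Finset.prod_mul_distrib, h1, one_mul]
  exact hs σ hσ

/-- In a disjoint product `σ * π` inside `G ⊇ diagonal`, the factor `σ` is inside `G`.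
[folklore] -/
theorem mem_of_disjoint_mul_left {G : Finset (Fin n × Fin n)} (hdiag : ∀ i, (i, i) ∈ G)
    {σ π : Perm (Fin n)} (hd : Perm.Disjoint σ π) (hmem : ∀ i, (i, (σ * π) i) ∈ G) (i : Fin n) :
    (i, σ i) ∈ G := by
  rcases hd i with h | h
  · rw [h]; exact hdiag i
  · have := hmem i; rwa [Perm.mul_apply, h] at this

/-- In a disjoint product `σ * π` inside `G ⊇ diagonal`, the factor `π` is inside `G`.
[folklore] -/
theorem mem_of_disjoint_mul_right {G : Finset (Fin n × Fin n)} (hdiag : ∀ i, (i, i) ∈ G)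
    {σ π : Perm (Fin n)} (hd : Perm.Disjoint σ π) (hmem : ∀ i, (i, (σ * π) i) ∈ G) (i : Fin n) :
    (i, π i) ∈ G := by
  rcases hd (π i) with h | h
  · have := hmem i; rwa [Perm.mul_apply, h] at this
  · rw [π.injective h]; exact hdiag i

/-- Weights are multiplicative over disjoint products when the diagonal weighs `1`. [folklore] -/
theorem prod_disjoint_mul {s : Fin n × Fin n → ℤˣ} (h1 : ∀ i, s (i, i) = 1) {σ π : Perm (Fin n)}
    (hd : Perm.Disjoint σ π) :
    ∏ i, s (i, (σ * π) i) = (∏ i, s (i, σ i)) * ∏ i, s (i, π i) := by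
  rw [← Finset.prod_mul_distrib]
  refine Finset.prod_congr rfl fun i _ => ?_
  rw [Perm.mul_apply]
  rcases hd i with hσi | hπi
  · have hfix : σ (π i) = π i := by
      rcases hd (π i) with h | h
      · exact h
      · rw [π.injective h, hσi]
    rw [hfix, hσi, h1, one_mul]
  · rw [hπi, h1, mul_one]

/-- **Pfaffian ⟺ every directed circuit is positive** (Little 1975 §2 (11); Robertson–Seymour–
Thomas 1999 (7.4): `G` Pfaffian iff `D(G, M)` is not even). For `G` containing the diagonal
perfect matching: `G` is Pfaffian iff there is a `±1`-signing, `+1` on the diagonal, under which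
every cyclic permutation `γ` inside `G` — every directed circuit of `D(G, M)` — satisfies
`sign γ * ∏ i, s (i, γ i) = 1`. [cite: Little1975, §2 (11)] -/
theorem isPfaffianBipartite_iff_forall_isCycle {G : Finset (Fin n × Fin n)}
    (hdiag : ∀ i, (i, i) ∈ G) :
    IsPfaffianBipartite G ↔ ∃ s : Fin n × Fin n → ℤˣ, (∀ i, s (i, i) = 1) ∧
      ∀ γ : Perm (Fin n), γ.IsCycle → (∀ i, (i, γ i) ∈ G) →
        Perm.sign γ * ∏ i, s (i, γ i) = 1 := by
  constructor
  · intro hG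
    obtain ⟨s, hs, h1⟩ := hG.exists_isPolyaSigning_diag hdiag
    exact ⟨s, h1, fun γ _ hγ => hs γ hγ⟩
  · rintro ⟨s, h1, hcyc⟩
    refine ⟨s, fun σ => ?_⟩
    induction σ using Perm.cycle_induction_on with
    | base_one => intro; simp [h1]
    | base_cycles σ hσ => exact hcyc σ hσ
    | induction_disjoint σ π hd _ ihσ ihπ =>
      intro hmem
      rw [Perm.sign_mul, prod_disjoint_mul h1 hd, mul_mul_mul_comm,
        ihσ (mem_of_disjoint_mul_left hdiag hd hmem), ihπ (mem_of_disjoint_mul_right hdiag hd hmem),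
        one_mul]

/-- The same with the sign of a cyclic permutation made explicit (`Equiv.Perm.IsCycle.sign`): a
directed circuit through `ℓ = #γ.support` matched pairs is positive iff the product of its signs
is `-(-1)^ℓ`, i.e. iff it carries an odd number of `-1`'s exactly when `ℓ` is even (Little's
"odd set" / Seymour–Thomassen's "odd weighting" condition). [cite: Little1975, §2 (11)] -/
theorem isPfaffianBipartite_iff_forall_isCycle' {G : Finset (Fin n × Fin n)}
    (hdiag : ∀ i, (i, i) ∈ G) :
    IsPfaffianBipartite G ↔ ∃ s : Fin n × Fin n → ℤˣ, (∀ i, s (i, i) = 1) ∧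
      ∀ γ : Perm (Fin n), γ.IsCycle → (∀ i, (i, γ i) ∈ G) →
        ∏ i, s (i, γ i) = -(-1) ^ γ.support.card := by
  rw [isPfaffianBipartite_iff_forall_isCycle hdiag]
  refine exists_congr fun s => and_congr Iff.rfl (forall_congr' fun γ => forall_congr' fun hγ =>
    forall_congr' fun _ => ?_)
  rw [hγ.sign]
  -- `(-(-1)^ℓ) * P = 1 ↔ P = -(-1)^ℓ` in `ℤˣ`
  constructor
  · intro h
    calc ∏ i, s (i, γ i) = (-(-1) ^ γ.support.card * (-(-1) ^ γ.support.card)) *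
        ∏ i, s (i, γ i) := by rw [Int.units_mul_self, one_mul]
      _ = -(-1) ^ γ.support.card := by rw [mul_assoc, h, mul_one]
  · intro h
    rw [h, Int.units_mul_self]

/-- **An edge on no directed circuit is irrelevant**: if `(i, j)` (`i ≠ j`) lies on no cyclic
permutation inside `G`, then `G` is Pfaffian iff `G.erase (i, j)` is (the two graphs have the
same perfect matchings). [folklore] -/
theorem isPfaffianBipartite_erase_iff_of_forall_isCycle {G : Finset (Fin n × Fin n)}
    (hdiag : ∀ i, (i, i) ∈ G) {a b : Fin n} (hab : a ≠ b)
    (h : ∀ γ : Perm (Fin n), γ.IsCycle → (∀ i, (i, γ i) ∈ G) → γ a ≠ b) :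
    IsPfaffianBipartite (G.erase (a, b)) ↔ IsPfaffianBipartite G := by
  have hdiag' : ∀ i, (i, i) ∈ G.erase (a, b) := fun i =>
    Finset.mem_erase.2 ⟨fun he => hab ((Prod.ext_iff.1 he).1.symm.trans (Prod.ext_iff.1 he).2),
      hdiag i⟩
  rw [isPfaffianBipartite_iff_forall_isCycle hdiag, isPfaffianBipartite_iff_forall_isCycle hdiag']
  refine exists_congr fun s => and_congr Iff.rfl ⟨fun H γ hγ hmem => ?_, fun H γ hγ hmem => ?_⟩
  · refine H γ hγ fun i => Finset.mem_erase.2 ⟨fun he => ?_, hmem i⟩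
    have hi : i = a := (Prod.ext_iff.1 he).1
    subst hi
    exact h γ hγ hmem (Prod.ext_iff.1 he).2
  · exact H γ hγ fun i => Finset.mem_of_mem_erase (hmem i)

end Literature.Combinatorics.SimpleGraph
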